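import Literature.AlgebraicGeometry.Resolution.ExceptionalDivisorProjectiveBundleAffine
import Literature.AlgebraicGeometry.Motives.ProjectiveSpaceOverAffineProduct
import HarnessLib

/-!
# The exceptional divisor is trivial over an affine open of the base where the centre is cut out by a quasi-regular sequence

Topic: `Literature/AlgebraicGeometry/Resolution`. Theorem-only file. Globalisation step for Hartshorne II
Thm. 8.24 (b) / Liu Thm. 8.1.19 (b) ("`E ≅ ℙ(𝓘/𝓘²)`", a projective bundle over the centre): let
`β : B → V` be a blowing up of a `k`-scheme along the kernel of a closed immersion `i : Z ↪ V`, and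
`W ⊆ V` an affine open on which `(ker i)|_W` is generated by a quasi-regular sequence `x₀, …, xₙ` of
`Γ(W, 𝒪)`. Then over `U = i⁻¹W` the exceptional divisor `E = B ×_V Z → Z` is the product:
`E|_U ≅ U × ℙⁿ_k` over `U` (`exists_iso_tensor_projectiveSpace_of_generators`). Ingredients:

* `ker_morphismRestrict_of_isClosedImmersion` — `ker (i|_W) = (ker i)|_W`;
* `exists_isPullback_preimage_restrict` — `E|_{q⁻¹U}` is the fibre product of the restrictions
  `β|_W : β⁻¹W → W` and `i|_W : U → W` (pasting of cartesian squares);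
* the affine form `E' ≅ ℙⁿ_{Γ(U, 𝒪)}` (`exists_iso_pullback_proj_of_isQuasiRegular`,
  `ExceptionalDivisorProjectiveBundleAffine.lean`) and `ℙⁿ_S = Spec S ×_k ℙⁿ_k`
  (`exists_iso_tensor_projectiveSpace_of_iso_proj`, `Motives/ProjectiveSpaceOverAffineProduct.lean`).

## References

* [Hartshorne1977] R. Hartshorne, Algebraic Geometry (1977), II Thm. 8.24 (b).
* [Liu2002] Q. Liu, Algebraic Geometry and Arithmetic Curves (2002), Thm. 8.1.19 (b), Ex. 3.1.10.
* [StacksProject] The Stacks Project, Tag 0804.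
-/

noncomputable section

open CategoryTheory CategoryTheory.Limits AlgebraicGeometry TopologicalSpace Opposite
open MonoidalCategory CartesianMonoidalCategory
open Literature.AlgebraicGeometry.Motives Literature.AlgebraicGeometry.Motives.Segre

namespace Literature.AlgebraicGeometry.Resolution

universe u

/-- **`ker (f|_U) = (ker f)|_U`** for a closed immersion `f` and an open `U` of the target
(`f|_U` is, up to an isomorphism of sources, the base change `pullback.fst U.ι f`, whose kernel is
`(ker f) · 𝒪_U`, Mathlib `ker_fst_of_isClosedImmersion`). [folklore] -/
theorem ker_morphismRestrict_of_isClosedImmersion {X Y : Scheme.{u}} (f : X ⟶ Y) [IsClosedImmersion f]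
    (U : Y.Opens) : (f ∣_ U).ker = f.ker.comap U.ι := by
  change ((pullbackRestrictIsoRestrict f U).inv ≫ pullback.snd f U.ι).ker = _
  rw [Scheme.Hom.ker_comp_of_isIso, ← pullbackSymmetry_hom_comp_fst, Scheme.Hom.ker_comp_of_isIso,
    Scheme.IdealSheafData.ker_fst_of_isClosedImmersion]

/-- **Restricting a fibre product over an open of the base.** For `β : X' → M`, `i₀ : B → M` and an open
`W ⊆ M`, the open `q⁻¹(i₀⁻¹W)` of `E = X' ×_M B` (`q = pr₂`) is the fibre product of the restrictions
`β|_W : β⁻¹W → W` and `i₀|_W : i₀⁻¹W → W`, with second projection `q|_{i₀⁻¹W}` (pasting of the cartesian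
squares `E|_{q⁻¹U} → E → X'` over `U → B → M` and `β⁻¹W → X'` over `W → M`). [folklore] -/
theorem exists_isPullback_preimage_restrict {X' M B : Scheme.{u}} (β : X' ⟶ M) (i₀ : B ⟶ M)
    (W : M.Opens) :
    ∃ a : (↑(pullback.snd β i₀ ⁻¹ᵁ (i₀ ⁻¹ᵁ W)) : Scheme.{u}) ⟶ ↑(β ⁻¹ᵁ W),
      IsPullback a (pullback.snd β i₀ ∣_ (i₀ ⁻¹ᵁ W)) (β ∣_ W) (i₀ ∣_ W) := by
  have hrange : Set.range ((pullback.snd β i₀ ⁻¹ᵁ (i₀ ⁻¹ᵁ W)).ι ≫ pullback.fst β i₀) ⊆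
      Set.range (β ⁻¹ᵁ W).ι := by
    rw [Scheme.Opens.range_ι]
    rintro _ ⟨e, rfl⟩
    change β (pullback.fst β i₀ ((pullback.snd β i₀ ⁻¹ᵁ (i₀ ⁻¹ᵁ W)).ι e)) ∈ W
    rw [← Scheme.Hom.comp_apply, pullback.condition, Scheme.Hom.comp_apply]
    exact e.2
  let a := IsOpenImmersion.lift (β ⁻¹ᵁ W).ι
    ((pullback.snd β i₀ ⁻¹ᵁ (i₀ ⁻¹ᵁ W)).ι ≫ pullback.fst β i₀) hrange
  have ha : a ≫ (β ⁻¹ᵁ W).ι = (pullback.snd β i₀ ⁻¹ᵁ (i₀ ⁻¹ᵁ W)).ι ≫ pullback.fst β i₀ :=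
    IsOpenImmersion.lift_fac _ _ _
  refine ⟨a, ?_⟩
  have big : IsPullback ((pullback.snd β i₀ ⁻¹ᵁ (i₀ ⁻¹ᵁ W)).ι ≫ pullback.fst β i₀)
      (pullback.snd β i₀ ∣_ (i₀ ⁻¹ᵁ W)) β ((i₀ ⁻¹ᵁ W).ι ≫ i₀) :=
    (isPullback_morphismRestrict (pullback.snd β i₀) (i₀ ⁻¹ᵁ W)).flip.paste_horiz
      (IsPullback.of_hasPullback β i₀)
  rw [← ha, ← morphismRestrict_ι] at big
  refine big.of_right ?_ (isPullback_morphismRestrict β W).flip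
  -- `a ≫ β|_W = q|_U ≫ i₀|_W`: check after the monomorphism `W ↪ M`
  have ha' : a ≫ (β ⁻¹ᵁ W).ι ≫ β = (pullback.snd β i₀ ⁻¹ᵁ (i₀ ⁻¹ᵁ W)).ι ≫ pullback.fst β i₀ ≫ β := by
    rw [← Category.assoc, ha, Category.assoc]
  rw [← cancel_mono W.ι]
  simp only [Category.assoc, morphismRestrict_ι]
  rw [ha', pullback.condition, morphismRestrict_ι_assoc]

/-- **The exceptional divisor is `U × ℙⁿ` over an affine open where the centre is cut out by a
quasi-regular sequence** (Hartshorne II Thm. 8.24 (b) / Liu Thm. 8.1.19 (b), Zariski-locally): for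
`k`-schemes `V, Z, B`, a closed `k`-immersion `i : Z ↪ V`, a blowing up `β : B → V` along `ker i`, and an
affine open `W ⊆ V` with `(ker i)|_W (W) = (x₀, …, xₙ)`, `x` quasi-regular in `Γ(W, 𝒪_W)`: with
`q = pr₂ : E = B ×_V Z → Z` and `U = i⁻¹W`, there is an isomorphism of `k`-schemes
`E|_{q⁻¹U} ≅ U × ℙⁿ_k` whose first component is `q`. [cite: Hartshorne1977, II Thm. 8.24 (b)]
[cite: Liu2002, Thm. 8.1.19 (b) and Ex. 3.1.10] -/
theorem exists_iso_tensor_projectiveSpace_of_generators {k : Type u} [Field k] {V Z B : SchemeOver k}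
    (i : Z ⟶ V) (β : B ⟶ V) [IsClosedImmersion i.left] (hβ : IsBlowup β.left i.left.ker)
    (W : V.left.Opens) (hW : IsAffineOpen W) {n : ℕ} (x : Fin (n + 1) → Γ(↑W, ⊤))
    (hgen : Ideal.span (Set.range x) = (i.left.ker.comap W.ι).ideal ⟨⊤, @isAffineOpen_top _ hW⟩)
    (hqr : IsQuasiRegular x) :
    ∃ ψ : (Over.mk ((pullback.snd β.left i.left ⁻¹ᵁ (i.left ⁻¹ᵁ W)).ι ≫ pullback.snd β.left i.left ≫
          Z.hom) : SchemeOver k) ≅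
        (Over.mk ((i.left ⁻¹ᵁ W).ι ≫ Z.hom) : SchemeOver k) ⊗ projectiveSpace n k,
      ψ.hom.left ≫ (fst (Over.mk ((i.left ⁻¹ᵁ W).ι ≫ Z.hom) : SchemeOver k) (projectiveSpace n k)).left ≫
          (i.left ⁻¹ᵁ W).ι =
        (pullback.snd β.left i.left ⁻¹ᵁ (i.left ⁻¹ᵁ W)).ι ≫ pullback.snd β.left i.left := by
  haveI : IsAffine (W : Scheme.{u}) := hW
  -- the restricted blowing up over the affine `W`, along `ker (i|_W) = (ker i)|_W`
  have hβ' : IsBlowup (β.left ∣_ W) (i.left ∣_ W).ker := by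
    rw [ker_morphismRestrict_of_isClosedImmersion]
    exact hβ.restrict W
  have hgen' : Ideal.span (Set.range x) = (i.left ∣_ W).ker.ideal ⟨⊤, isAffineOpen_top _⟩ := by
    rw [ker_morphismRestrict_of_isClosedImmersion]
    exact hgen
  -- `E' = (β⁻¹W) ×_W U ≅ ℙⁿ_{Γ(U, 𝒪)}` over `Spec Γ(U, 𝒪)`
  obtain ⟨φ, hφ⟩ := exists_iso_pullback_proj_of_isQuasiRegular hβ' x hgen' hqr
  -- `E|_{q⁻¹U} ≅ E'` over `U`
  obtain ⟨a, hP⟩ := exists_isPullback_preimage_restrict β.left i.left W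
  -- the `k`-morphism `q|_U : E|_{q⁻¹U} → U`
  let EO : SchemeOver k := Over.mk ((pullback.snd β.left i.left ⁻¹ᵁ (i.left ⁻¹ᵁ W)).ι ≫
    pullback.snd β.left i.left ≫ Z.hom)
  let UO : SchemeOver k := Over.mk ((i.left ⁻¹ᵁ W).ι ≫ Z.hom)
  let g : EO ⟶ UO := Over.homMk (pullback.snd β.left i.left ∣_ (i.left ⁻¹ᵁ W)) (by
    change (pullback.snd β.left i.left ∣_ (i.left ⁻¹ᵁ W)) ≫ (i.left ⁻¹ᵁ W).ι ≫ Z.hom =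
      (pullback.snd β.left i.left ⁻¹ᵁ (i.left ⁻¹ᵁ W)).ι ≫ pullback.snd β.left i.left ≫ Z.hom
    rw [← Category.assoc, morphismRestrict_ι, Category.assoc])
  haveI : IsAffine UO.left := hW.preimage i.left
  have hΦ : (hP.isoPullback ≪≫ φ).hom ≫ toSpec (Fin (n + 1)) Γ(UO.left, ⊤) = g.left ≫ UO.left.toSpecΓ := by
    change (hP.isoPullback.hom ≫ φ.hom) ≫ toSpec (Fin (n + 1)) Γ(↑(i.left ⁻¹ᵁ W), ⊤) =
      (pullback.snd β.left i.left ∣_ (i.left ⁻¹ᵁ W)) ≫ Scheme.toSpecΓ ↑(i.left ⁻¹ᵁ W)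
    rw [Category.assoc, hφ, ← Category.assoc, IsPullback.isoPullback_hom_snd]
  obtain ⟨ψ, hψ⟩ := exists_iso_tensor_projectiveSpace_of_iso_proj g (hP.isoPullback ≪≫ φ) hΦ
  refine ⟨ψ, ?_⟩
  have h1 : ψ.hom.left ≫ (fst UO (projectiveSpace n k)).left = pullback.snd β.left i.left ∣_ (i.left ⁻¹ᵁ W) :=
    congrArg (fun t ↦ t.left) hψ
  calc ψ.hom.left ≫ (fst UO (projectiveSpace n k)).left ≫ (i.left ⁻¹ᵁ W).ι
        = (ψ.hom.left ≫ (fst UO (projectiveSpace n k)).left) ≫ (i.left ⁻¹ᵁ W).ι := (Category.assoc _ _ _).symm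
    _ = (pullback.snd β.left i.left ∣_ (i.left ⁻¹ᵁ W)) ≫ (i.left ⁻¹ᵁ W).ι := by rw [h1]; rfl
    _ = (pullback.snd β.left i.left ⁻¹ᵁ (i.left ⁻¹ᵁ W)).ι ≫ pullback.snd β.left i.left :=
      morphismRestrict_ι _ _

end Literature.AlgebraicGeometry.Resolution

end
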